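import Summits.NavierStokesRegularity.NavierStokesRegularity.Theses.AngularGalerkinLadder
import HarnessLib

/-!
# Census stratum (S17): no window profile — and no witness of K1 — has a slice whose pointwise
# norm is non-decreasing under a screw displacement with non-zero advance along its axis; in
# particular no PERIODIC and no HELICALLY SYMMETRIC window slice

Refuter seat (ns-blowup-refuter g18), kernel census for crux K2 `NoOverheating`
(stmt-NavierStokesRegularity-19960) of route `AngularGalerkinLadder`, Negative lane (`--supports`).
No definition, no named fact, no item verdict moves; nothing is asserted about Navier–Stokes —
a KINEMATIC consequence of Type-I spatial decay alone.

## The mechanism (§1)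

Let `v : ℝ³ → ℝ³` obey the Type-I slice decay `‖v x‖ ≤ C / (‖x‖ + a)` with `a > 0`, and suppose its
pointwise norm is non-decreasing under the screw displacement `x ↦ S x + h` (`S` a linear isometry,
`S h = h`, `h ≠ 0`): `‖v x‖ ≤ ‖v (S x + h)‖`.  Iterating, `‖v x‖ ≤ ‖v yₙ‖` along the orbit
`y₀ = x`, `yₙ₊₁ = S yₙ + h`, and `⟪h, yₙ⟫ = ⟪h, x⟫ + n ‖h‖²` (because `⟪h, S y⟫ = ⟪S h, S y⟫ = ⟪h, y⟫`),
so `‖yₙ‖ ≥ n ‖h‖ − ‖x‖ → ∞` and `‖v x‖ ≤ C / (‖yₙ‖ + a) → 0`: `v ≡ 0`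
(`eq_zero_of_decay_of_norm_le_norm_screw`).  Equality under the displacement (periodicity
`v (x + h) = v x`; helical symmetry = invariance under a rotation about `ℝh` composed with the
translation by `h`; any discrete screw symmetry with non-zero advance) is the special case
`‖v x‖ = ‖v (S x + h)‖`.

## On the ladder (§2, §3)

A rung profile has Type-I decay `‖u (t, x)‖ ≤ C₀ / (‖x‖ + √(−t))` at every `t < 0`, so a slice
`u (t, ·)` with screw-monotone norm vanishes (`rungProfile_slice_eq_zero_of_screwMonotone`); a
window profile (`0 < δ ≤ ‖u (−1, x₀)‖`) cannot have such a slice at `t = −1`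
(`no_windowProfile_screwMonotone_slice`, (S17)), in particular not a periodic one
(`no_windowProfile_periodic_slice`) nor a screw- or helically-invariant one
(`no_windowProfile_screwInvariant_slice`); a witness of K1 cannot have one at any negative time at
which it is non-zero (`not_nontrivial_rungProfile_of_screwMonotone`); K1 ∧ (K2 supplied by such
profiles) is contradictory (`not_cofinal_and_noOverheating_screwMonotone`).

This is the shadow, on the Type-I rotated-DSS rung-profile class, of the printed symmetry class with
a GLOBAL REGULARITY theorem — helically symmetric flows (Mahalov–Titi–Leibovich 1990) — and of every
spatially periodic-in-one-direction ansatz: on the ladder they are excluded before any dynamics, by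
decay.  It complements (S10) (`TranslationalSymmetryExcluded`: slice norms invariant under a
CONTINUOUS one-parameter screw/translation group) with the DISCRETE case, which (S10) does not cover.

References: [cite: MahalovTitiLeibovich1990, Thm. 3.3 (global strong helical solutions; quoted in Robinson–Rodrigo–Sadowski 2016, p. 112)];
[cite: KochNadirashviliSereginSverak2009, Thm. 5.3 and §5 (bounded ancient solutions; symmetry reductions)].
-/

noncomputable section

namespace Summit.NavierStokesRegularity.AngularGalerkinLadderScrewPeriodicExcluded

open Set Function Filter Topology Metric
open scoped RealInnerProductSpace
open Literature.Analysis Literature.Analysis.FluidPDE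
open Summit.NavierStokesRegularity.FluidComputer
open Summit.NavierStokesRegularity.FluidComputer.AngularLadder
open Summit.NavierStokesRegularity.NavierStokesRegularity.Theses.AngularGalerkinLadder

/-! ### §1 Type-I spatial decay versus a screw-monotone norm -/

/-- Along the screw orbit `y₀ = x`, `yₙ₊₁ = S yₙ + h` (`S h = h`) the axial coordinate grows
linearly, `⟪h, yₙ⟫ = ⟪h, x⟫ + n‖h‖²`, and a screw-monotone norm is carried along:
`‖v x‖ ≤ ‖v yₙ‖`. [cite: MahalovTitiLeibovich1990, Thm. 3.3 (global strong helical solutions; quoted in Robinson–Rodrigo–Sadowski 2016, p. 112)] -/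
theorem exists_screw_iterate {v : EuclideanSpace ℝ (Fin 3) → EuclideanSpace ℝ (Fin 3)}
    (S : EuclideanSpace ℝ (Fin 3) ≃ₗᵢ[ℝ] EuclideanSpace ℝ (Fin 3)) {h : EuclideanSpace ℝ (Fin 3)}
    (hSh : S h = h) (hmono : ∀ x, ‖v x‖ ≤ ‖v (S x + h)‖) (x : EuclideanSpace ℝ (Fin 3)) (n : ℕ) :
    ∃ y : EuclideanSpace ℝ (Fin 3), ⟪h, y⟫ = ⟪h, x⟫ + n * ‖h‖ ^ 2 ∧ ‖v x‖ ≤ ‖v y‖ := by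
  induction n with
  | zero => exact ⟨x, by simp, le_rfl⟩
  | succ n ih =>
    obtain ⟨y, hy, hvy⟩ := ih
    refine ⟨S y + h, ?_, hvy.trans (hmono y)⟩
    have hSy : ⟪h, S y⟫ = ⟪h, y⟫ := by simpa [hSh] using S.inner_map_map h y
    rw [inner_add_right, hSy, hy, real_inner_self_eq_norm_sq]
    push_cast
    ring

/-- **Type-I spatial decay kills every field whose pointwise norm is non-decreasing under a screw
displacement with non-zero advance along its axis** (in particular every periodic, helically
symmetric or discretely screw-symmetric decaying field): if `‖v x‖ ≤ C / (‖x‖ + a)` (`a > 0`) and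
`‖v x‖ ≤ ‖v (S x + h)‖` for a linear isometry `S` with `S h = h ≠ 0`, then `v ≡ 0`.
[cite: MahalovTitiLeibovich1990, Thm. 3.3 (global strong helical solutions; quoted in Robinson–Rodrigo–Sadowski 2016, p. 112)] -/
theorem eq_zero_of_decay_of_norm_le_norm_screw
    {v : EuclideanSpace ℝ (Fin 3) → EuclideanSpace ℝ (Fin 3)} {C a : ℝ} (ha : 0 < a)
    (hdec : ∀ x, ‖v x‖ ≤ C / (‖x‖ + a))
    (S : EuclideanSpace ℝ (Fin 3) ≃ₗᵢ[ℝ] EuclideanSpace ℝ (Fin 3)) {h : EuclideanSpace ℝ (Fin 3)}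
    (hSh : S h = h) (hh : h ≠ 0) (hmono : ∀ x, ‖v x‖ ≤ ‖v (S x + h)‖)
    (x : EuclideanSpace ℝ (Fin 3)) : v x = 0 := by
  by_contra hx
  have hε : 0 < ‖v x‖ := norm_pos_iff.2 hx
  have hh' : 0 < ‖h‖ := norm_pos_iff.2 hh
  obtain ⟨n, hn⟩ := exists_nat_gt ((C / ‖v x‖ + ‖x‖) / ‖h‖)
  obtain ⟨y, hy, hvy⟩ := exists_screw_iterate S hSh hmono x n
  -- the orbit point `y` is far out: `n‖h‖ − ‖x‖ ≤ ‖y‖`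
  have h1 : ⟪h, y⟫ ≤ ‖h‖ * ‖y‖ := real_inner_le_norm h y
  have h2 : -(‖h‖ * ‖x‖) ≤ ⟪h, x⟫ := neg_le_of_abs_le (abs_real_inner_le_norm h x)
  have h3 : ‖h‖ * ((n : ℝ) * ‖h‖ - ‖x‖) ≤ ‖h‖ * ‖y‖ := by nlinarith [h1, h2, hy]
  have hyn : (n : ℝ) * ‖h‖ - ‖x‖ ≤ ‖y‖ := le_of_mul_le_mul_left h3 hh'
  -- hence the decay bound at `y` is below `‖v x‖`
  have hya : 0 < ‖y‖ + a := by positivity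
  have h4 : C / ‖v x‖ < ‖y‖ + a := by
    have := (div_lt_iff₀ hh').1 hn
    linarith
  have h5 : C < ‖v x‖ * (‖y‖ + a) := by
    have := (div_lt_iff₀ hε).1 h4
    linarith
  have h6 : C / (‖y‖ + a) < ‖v x‖ := (div_lt_iff₀ hya).2 h5
  exact absurd (hvy.trans (hdec y)) (not_le.2 h6)

/-- The invariant special case: a decaying field INVARIANT under a screw displacement with non-zero
advance (`v (S x + h) = v x`; periodic for `S = 1`, helically symmetric for `S` a rotation about
`ℝh`) vanishes identically. [cite: MahalovTitiLeibovich1990, Thm. 3.3 (global strong helical solutions; quoted in Robinson–Rodrigo–Sadowski 2016, p. 112)] -/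
theorem eq_zero_of_decay_of_screwInvariant
    {v : EuclideanSpace ℝ (Fin 3) → EuclideanSpace ℝ (Fin 3)} {C a : ℝ} (ha : 0 < a)
    (hdec : ∀ x, ‖v x‖ ≤ C / (‖x‖ + a))
    (S : EuclideanSpace ℝ (Fin 3) ≃ₗᵢ[ℝ] EuclideanSpace ℝ (Fin 3)) {h : EuclideanSpace ℝ (Fin 3)}
    (hSh : S h = h) (hh : h ≠ 0) (hinv : ∀ x, v (S x + h) = v x)
    (x : EuclideanSpace ℝ (Fin 3)) : v x = 0 :=
  eq_zero_of_decay_of_norm_le_norm_screw ha hdec S hSh hh (fun y => (hinv y).symm ▸ le_rfl) x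

/-! ### §2 Per profile -/

variable {L : ℕ} {C₀ cmin cmax δ ε c : ℝ}
  {R : EuclideanSpace ℝ (Fin 3) ≃ₗᵢ[ℝ] EuclideanSpace ℝ (Fin 3)}
  {u : ℝ → EuclideanSpace ℝ (Fin 3) → EuclideanSpace ℝ (Fin 3)}
  {p : ℝ → EuclideanSpace ℝ (Fin 3) → ℝ}
  {d : ℝ → EuclideanSpace ℝ (Fin 3) → EuclideanSpace ℝ (Fin 3)}

/-- A rung-profile slice at a negative time whose norm is screw-monotone (`‖u t x‖ ≤ ‖u t (S x + h)‖`,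
`S h = h ≠ 0`) vanishes identically — Type-I decay `C₀ / (‖x‖ + √(−t))` and §1.
[cite: MahalovTitiLeibovich1990, Thm. 3.3 (global strong helical solutions; quoted in Robinson–Rodrigo–Sadowski 2016, p. 112)] -/
theorem rungProfile_slice_eq_zero_of_screwMonotone (hP : IsRungProfile L C₀ c R u p d) {t : ℝ}
    (ht : t < 0) (S : EuclideanSpace ℝ (Fin 3) ≃ₗᵢ[ℝ] EuclideanSpace ℝ (Fin 3))
    {h : EuclideanSpace ℝ (Fin 3)} (hSh : S h = h) (hh : h ≠ 0)
    (hmono : ∀ x, ‖u t x‖ ≤ ‖u t (S x + h)‖) : ∀ x, u t x = 0 :=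
  eq_zero_of_decay_of_norm_le_norm_screw (Real.sqrt_pos.2 (neg_pos.2 ht))
    (hP.hasTypeIDecay t ht) S hSh hh hmono

/-- **No NONTRIVIAL rung profile (witness of K1's `RungIsSingular L`) has, at every negative time, a
slice with screw-monotone norm** (time-dependent screw allowed).
[cite: MahalovTitiLeibovich1990, Thm. 3.3 (global strong helical solutions; quoted in Robinson–Rodrigo–Sadowski 2016, p. 112)] -/
theorem not_nontrivial_rungProfile_of_screwMonotone (hP : IsRungProfile L C₀ c R u p d)
    (hmono : ∀ t < 0, ∃ (S : EuclideanSpace ℝ (Fin 3) ≃ₗᵢ[ℝ] EuclideanSpace ℝ (Fin 3))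
      (h : EuclideanSpace ℝ (Fin 3)), S h = h ∧ h ≠ 0 ∧ ∀ x, ‖u t x‖ ≤ ‖u t (S x + h)‖) :
    ¬ ∃ t < 0, ∃ x, u t x ≠ 0 := by
  rintro ⟨t, ht, x, hx⟩
  obtain ⟨S, h, hSh, hh, hm⟩ := hmono t ht
  exact hx (rungProfile_slice_eq_zero_of_screwMonotone hP ht S hSh hh hm x)

/-! ### §3 (S17) on K2's windows, and the K1 ∧ K2 reading -/

/-- **(S17) No window profile has a window slice `u (−1, ·)` with screw-monotone norm**
(`‖u (−1) x‖ ≤ ‖u (−1) (S x + h)‖`, `S h = h ≠ 0`): the slice would vanish, against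
`0 < δ ≤ ‖u (−1, x₀)‖`. [cite: MahalovTitiLeibovich1990, Thm. 3.3 (global strong helical solutions; quoted in Robinson–Rodrigo–Sadowski 2016, p. 112)] -/
theorem no_windowProfile_screwMonotone_slice (hδ : 0 < δ)
    (hW : IsWindowProfile L C₀ cmin cmax δ ε c R u p d)
    (S : EuclideanSpace ℝ (Fin 3) ≃ₗᵢ[ℝ] EuclideanSpace ℝ (Fin 3)) {h : EuclideanSpace ℝ (Fin 3)}
    (hSh : S h = h) (hh : h ≠ 0) (hmono : ∀ x, ‖u (-1) x‖ ≤ ‖u (-1) (S x + h)‖) : False := by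
  obtain ⟨hP, -, -, ⟨x₀, hx₀⟩, -⟩ := hW
  rw [rungProfile_slice_eq_zero_of_screwMonotone hP (by norm_num) S hSh hh hmono x₀, norm_zero]
    at hx₀
  exact absurd hx₀ (not_le.2 hδ)

/-- (S17), invariant form: no window slice is invariant under a screw displacement with non-zero
advance — no helically symmetric and no discretely screw-symmetric window slice.
[cite: MahalovTitiLeibovich1990, Thm. 3.3 (global strong helical solutions; quoted in Robinson–Rodrigo–Sadowski 2016, p. 112)] -/
theorem no_windowProfile_screwInvariant_slice (hδ : 0 < δ)
    (hW : IsWindowProfile L C₀ cmin cmax δ ε c R u p d)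
    (S : EuclideanSpace ℝ (Fin 3) ≃ₗᵢ[ℝ] EuclideanSpace ℝ (Fin 3)) {h : EuclideanSpace ℝ (Fin 3)}
    (hSh : S h = h) (hh : h ≠ 0) (hinv : ∀ x, u (-1) (S x + h) = u (-1) x) : False :=
  no_windowProfile_screwMonotone_slice hδ hW S hSh hh fun x => (hinv x).symm ▸ le_rfl

/-- (S17), periodic form: no window slice is periodic (even only in norm, even only monotone:
`‖u (−1) x‖ ≤ ‖u (−1) (x + h)‖`, `h ≠ 0`). [cite: MahalovTitiLeibovich1990, Thm. 3.3 (global strong helical solutions; quoted in Robinson–Rodrigo–Sadowski 2016, p. 112)] -/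
theorem no_windowProfile_periodic_slice (hδ : 0 < δ)
    (hW : IsWindowProfile L C₀ cmin cmax δ ε c R u p d) {h : EuclideanSpace ℝ (Fin 3)}
    (hh : h ≠ 0) (hmono : ∀ x, ‖u (-1) x‖ ≤ ‖u (-1) (x + h)‖) : False :=
  no_windowProfile_screwMonotone_slice hδ hW (LinearIsometryEquiv.refl ℝ _) rfl hh
    (by simpa using hmono)

/-- **K1 ∧ (K2 supplied by window profiles with a screw-monotone window slice) is contradictory.**
[cite: MahalovTitiLeibovich1990, Thm. 3.3 (global strong helical solutions; quoted in Robinson–Rodrigo–Sadowski 2016, p. 112)] -/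
theorem not_cofinal_and_noOverheating_screwMonotone (C₀ : ℝ) :
    ¬ (RungBlowupCofinal ∧ ∃ (cmin cmax δ : ℝ) (L₀ : ℕ) (ε : ℕ → ℝ), 1 < cmin ∧ 0 < δ ∧
        Tendsto ε atTop (𝓝 0) ∧ ∀ L ≥ L₀, RungIsSingular L →
          ∃ (c : ℝ) (R : EuclideanSpace ℝ (Fin 3) ≃ₗᵢ[ℝ] EuclideanSpace ℝ (Fin 3))
            (u : ℝ → EuclideanSpace ℝ (Fin 3) → EuclideanSpace ℝ (Fin 3))
            (p : ℝ → EuclideanSpace ℝ (Fin 3) → ℝ)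
            (d : ℝ → EuclideanSpace ℝ (Fin 3) → EuclideanSpace ℝ (Fin 3)),
            IsWindowProfile L C₀ cmin cmax δ (ε L) c R u p d ∧
              ∃ (S : EuclideanSpace ℝ (Fin 3) ≃ₗᵢ[ℝ] EuclideanSpace ℝ (Fin 3))
                (h : EuclideanSpace ℝ (Fin 3)), S h = h ∧ h ≠ 0 ∧
                  ∀ x, ‖u (-1) x‖ ≤ ‖u (-1) (S x + h)‖) := by
  rintro ⟨hK1, cmin, cmax, δ, L₀, ε, -, hδ, -, hsup⟩
  obtain ⟨L, hL, hsing⟩ := hK1 L₀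
  obtain ⟨c, R, u, p, d, hW, S, h, hSh, hh, hmono⟩ := hsup L hL hsing
  exact no_windowProfile_screwMonotone_slice hδ hW S hSh hh hmono

end Summit.NavierStokesRegularity.AngularGalerkinLadderScrewPeriodicExcluded

end
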